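import Summits.QuantumFields.BalabanUV.T4Continuum.Spine.NE3.NormalPartB8
import Summits.QuantumFields.BalabanUV.T4Continuum.Spine.NE3.NormalPartB8L1
import Summits.QuantumFields.BalabanUV.T4Continuum.Spine.NE3.QbarRightInverseB8
import Summits.QuantumFields.BalabanUV.T4Continuum.Spine.NE3.CovLiftCurlLettersB8
import Summits.QuantumFields.BalabanUV.T4Continuum.Spine.NE3.CovLiftDivergenceB8
import HarnessLib

/-!
# T⁴ programme, node NE3 — REPAIR R24 (γ): THE LANDAU LINEAR NORMAL PART OF THE B8 SUPPLIER AT THE LIFT OF THE SOLVED DATUM — existence of `Nn` with `QbarIter Nn = QbarIter Z`,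
# `IsLandauB8 Nn`, and the four ℓ-letters (R1)–(R4) against `φ := QbarIter L (j+1) W Z` with EXPLICIT k-free constants; only its two SUP currencies remain ([B9] §3 TYPE, F5)

Cell `pub-balaban-gaps` (YM blitz, track G2, seat `ne3`, unit `pub-balaban-gaps-ne3`; writer prover-pub-balaban-gaps-ne3-g3-0, 2026-08-23), census
`run/shared/lean/pub/pub-balaban-gaps/ne/NE3.md` §4 R24.  The instantiation of `Spine/NE3/NormalPartB8` ∕ `NormalPartB8L1` (generic in the first summand `Y`) at
`Y := covLift (L^{j+1}) W (ext((1+K)⁻¹ res φ))` (`Spine/NE3/QbarRightInverseB8.QbarIter_covLift_solveW`: `QbarIter Y = φ`; letters `covLift_solveW_R1`∕`_R4`,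
`CovLiftCurlLettersB8.covLift_solveW_R2`∕`_R3`; divergence `CovLiftDivergenceB8.sum_nhsNormSq_covDiv_covLift_le` with `NE3RightInverseSolveLetters.dirSq_solve_le`) and
`λ :=` its Landau correction (`LandauProjectionB8.exists_landauB8_correction`).  Constants (`θ_loc = thetaLoc·M²x`, `liftC = 24·8^{d−1}`):
`c₁ = (liftC∕(1−θ_loc))²`, `c₂ = 4d(liftC(17+16d))²∕(1−θ_loc)²`, `c₃ = 2d·liftC(17+16d)∕(1−θ_loc)`, `c₄ = liftC∕(1−θ_loc)`, `c_V = d·liftC²(2d+8)²∕(1−θ_loc)²`.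

CONTENT ([folklore]; 0 sorry; no `def`): `covDiv_lift_le` (the divergence quantity of the lift against `dirSq φ`), **`exists_landauNormalPart_lift`**.

HONEST FRAMING.  Instantiation bookkeeping over landed lemmas on OUR objects; the SUP letter and window sup-curl of `Nn` are NOT given (shape `LandauProjectionSupShape.LandauCorrectionSupB8`,
F5); nothing about Bałaban's minimisers; Π-REG, (P♮), (RES♯), the covariant root and **NE3 are NOT proved**; spine PROVED 0∕9; finite T⁴ rung (B)+1 — NOT infinite volume, NOT mass gap,
NOT `BetaPertH`, NOT Clay.  PLACEMENT: `Summits/QuantumFields/BalabanUV/T4Continuum/Spine/NE3/`; imports accepted modules only; moves nothing.  HONEST DEPENDENCY: continuum YM on T⁴ ⇐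
BetaPertH ∧ nine spine estimates (0/9 proved); BetaPertH ⇐ (D1) ∧ (D4) ∧ CAP+tail; G-an2-4 gates asym, D1 and NE2/3/4.
-/

set_option autoImplicit false

open scoped BigOperators Matrix Matrix.Norms.L2Operator
open NormedSpace Finset

namespace Summit.QuantumFields.BalabanUV.T4Continuum.NE3.NormalPartB8Lift

open Literature.MathematicalPhysics.QuantumFieldTheory.Balaban1983to89
open B7Prop1Explicit B7Prop2Explicit MatrixNorms
open T4AveragingDeficitWall (Ad IsUnitaryCfg IsSkewDir SmallField curl curlSq dirSq dirL1)
open T4AveragingDeficitWallBoundary (IsPeriodicCfg periodBox)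
open AveragingDeficitPeriodicCounting (IsPeriodicDir)
open AveragingDeficitTwoLevelPrep (prop1Radius skewSub)
open AveragingDeficitMultiLevelPrep (LevelSmall tower)
open AveragingDeficitTorusChart (TDir extDir resDir isPeriodicDir_extDir)
open BlockAveragePushDirGauge (gaugeDir)
open MinimalActionLevels (perWin)
open NE3CovariantWeitzenbock (covDiv)
open NE3TangentCovariantTower (QbarIter)
open NE3SmoothRightInverseW (solveW resSkew isSkewDir_QbarIter)
open NE3FramePotBoundW (isPeriodicDir_QbarIter tower_eq_pow_mul)
open NE3CovariantLift (covLift)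
open NE3QbarIterCovLiftPrep (cruxC liftC liftC_nonneg)
open NE3RightInverseSolveLetters (thetaLoc dirSq_solve_le)
open SpreadLift (loopRad)
open NE3.PairLandauB8 (avgKernelGauges IsLandauB8)
open NE3.LandauProjectionB8 (exists_landauB8_correction)
open NE3.QbarRightInverseB8 (QbarIter_covLift_solveW covLift_solveW_skew covLift_solveW_periodic covLift_solveW_R1 covLift_solveW_R4)
open NE3.CovLiftCurlLettersB8 (covLift_solveW_R2 covLift_solveW_R3)
open NE3.CovLiftDivergenceB8 (sum_nhsNormSq_covDiv_covLift_le)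
open NE3.NormalPartB8 (landauNormalPart_structure landauNormalPart_R1 landauNormalPart_R2)
open NE3.NormalPartB8L1 (landauNormalPart_R3 landauNormalPart_R4)

noncomputable section

variable {d : ℕ} {n : Type*} [Fintype n] [DecidableEq n]

section Lift

variable [Nonempty n] {L N : ℕ} [NeZero N] (hL : 2 ≤ L) (hN : 1 ≤ N) (hd : 1 ≤ d) (j : ℕ) {W : Site d → Fin d → (Matrix n n ℂ)ˣ} {x : ℝ}
  (hWu : IsUnitaryCfg W) (hWP : IsPeriodicCfg W ((N * L ^ (j + 1) : ℕ) : ℤ)) (hx : 0 ≤ x) (hs : LevelSmall d L j x) (hWx : SmallField W x)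
  (hθ : cruxC d L * (((L : ℝ) ^ (j + 1)) ^ 2 * x) < 1) (hθl : thetaLoc d L * (((L : ℝ) ^ (j + 1)) ^ 2 * x) < 1)
  (hε : ((L : ℝ) ^ (j + 1)) ^ 2 * x ≤ 1)
  {φ : Site d → Fin d → Matrix n n ℂ} (hφ : IsSkewDir φ)

include hN hd hθl hε in
/-- **THE DIVERGENCE QUANTITY OF THE LIFT OF THE SOLVED DATUM AGAINST `dirSq φ`**: `Σ_x nhsNormSq (covDiv_W (covLift M W Φ) x) ≤ c_V·(M^d∕M⁴)·dirSq φ (periodBox N)`,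
`c_V = d·liftC²(2d+8)²∕(1−θ_loc)²` (the divergence letter in the regime `M²x ≤ 1`, then the ℓ² solve letter). [folklore] -/
theorem covDiv_lift_le :
    ∑ y ∈ periodBox (d := d) (N * L ^ (j + 1)),
        nhsNormSq (covDiv W (covLift (L ^ (j + 1)) W (extDir N ((solveW hL j hWu hx hs hWx N hθ (resSkew N hφ) : ↥(skewSub d n N)) : TDir d n N))) y)
      ≤ ((d : ℝ) * liftC d ^ 2 * (2 * (d : ℝ) + 8) ^ 2 / (1 - thetaLoc d L * (((L : ℝ) ^ (j + 1)) ^ 2 * x)) ^ 2)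
          * (((L : ℝ) ^ (j + 1)) ^ d / ((L : ℝ) ^ (j + 1)) ^ 4) * dirSq φ (periodBox (d := d) N) := by
  set M : ℝ := (L : ℝ) ^ (j + 1) with hMdef
  set q : ℝ := 1 - thetaLoc d L * (M ^ 2 * x) with hqdef
  have hM0 : 0 < M := by rw [hMdef]; positivity
  have hM2 : 2 ≤ L ^ (j + 1) := hL.trans (Nat.le_self_pow (by omega) L)
  have hMr : ((L ^ (j + 1) : ℕ) : ℝ) = M := by rw [hMdef]; push_cast; ring
  have hpos : 0 < q := by rw [hqdef, hMdef]; linarith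
  set Φ : Site d → Fin d → Matrix n n ℂ := extDir N ((solveW hL j hWu hx hs hWx N hθ (resSkew N hφ) : ↥(skewSub d n N)) : TDir d n N) with hΦdef
  have hΦP : IsPeriodicDir Φ (N : ℤ) := isPeriodicDir_extDir N _
  have hV := sum_nhsNormSq_covDiv_covLift_le (n := n) hM2 hN hWu hx hWx hΦP
  rw [Nat.mul_comm (L ^ (j + 1)) N, hMr] at hV
  have hΦ2 : dirSq Φ (periodBox (d := d) N) ≤ dirSq φ (periodBox (d := d) N) / q ^ 2 := by
    rw [hqdef, hMdef]; exact dirSq_solve_le hL j hWu hx hs hWx N hθ hθl hφ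
  have hxM : x ≤ 1 / M ^ 2 := by rw [le_div_iff₀ (by positivity), hMdef]; linarith
  have hreg : 6 / M ^ 2 + 2 * ((d : ℝ) + 1) * x ≤ (2 * (d : ℝ) + 8) / M ^ 2 := by
    have h1 : 2 * ((d : ℝ) + 1) * x ≤ 2 * ((d : ℝ) + 1) * (1 / M ^ 2) := mul_le_mul_of_nonneg_left hxM (by positivity)
    have h2 : 6 / M ^ 2 + 2 * ((d : ℝ) + 1) * (1 / M ^ 2) = (2 * (d : ℝ) + 8) / M ^ 2 := by field_simp; ring
    linarith
  have hl0 := liftC_nonneg d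
  have hC2 : (liftC d * (6 / M ^ 2 + 2 * ((d : ℝ) + 1) * x)) ^ 2 ≤ (liftC d * ((2 * (d : ℝ) + 8) / M ^ 2)) ^ 2 :=
    pow_le_pow_left₀ (by positivity) (mul_le_mul_of_nonneg_left hreg hl0) 2
  have hDΦ0 : 0 ≤ dirSq Φ (periodBox (d := d) N) := by unfold dirSq; positivity
  have h1 : ∑ y ∈ periodBox (d := d) (N * L ^ (j + 1)), nhsNormSq (covDiv W (covLift (L ^ (j + 1)) W Φ) y)
      ≤ (d : ℝ) * (liftC d * ((2 * (d : ℝ) + 8) / M ^ 2)) ^ 2 * M ^ d * (dirSq φ (periodBox (d := d) N) / q ^ 2) := by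
    refine hV.trans ?_
    refine (mul_le_mul_of_nonneg_right (mul_le_mul_of_nonneg_right (mul_le_mul_of_nonneg_left hC2 (Nat.cast_nonneg d)) (by positivity)) hDΦ0).trans ?_
    exact mul_le_mul_of_nonneg_left hΦ2 (by positivity)
  have heq : (d : ℝ) * (liftC d * ((2 * (d : ℝ) + 8) / M ^ 2)) ^ 2 * M ^ d * (dirSq φ (periodBox (d := d) N) / q ^ 2)
      = ((d : ℝ) * liftC d ^ 2 * (2 * (d : ℝ) + 8) ^ 2 / q ^ 2) * (M ^ d / M ^ 4) * dirSq φ (periodBox (d := d) N) := by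
    have hM4 : M ^ 4 = M ^ 2 * M ^ 2 := by ring
    rw [hM4]
    field_simp
  rw [heq] at h1
  rw [hqdef, hMdef] at h1
  exact h1

include hL hN hd hWu hWP hx hs hWx hθ hθl hε in
/-- **THE LANDAU LINEAR NORMAL PART AT THE LIFT OF THE SOLVED DATUM — EXISTENCE WITH ALL ℓ-LETTERS** (`L ≥ 2`, `N, d ≥ 1`; `W` unitary, `(N·L^{j+1})`-periodic, in the level-`j`
small-field class with the solve smallness `θ, θ_loc < 1`, the regime `M²x ≤ 1`, K6-Ξ's Poincaré line; `Z` skew `(N·L^{j+1})`-periodic; `φ := QbarIter L (j+1) W Z`): there is `Nn`,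
skew, periodic, (1.38)-Landau, with `QbarIter L (j+1) W Nn = φ`, obeying (R1)–(R4) against `φ` with the constants of the module docstring:
`dirSq Nn ≤ (2c₁ + 8·card n·c_V)(M^d∕M²)dirSq φ`, `curlSq W Nn ≤ (2c₂ + 128·card(Plane)·card n·c_V)(M^d∕M⁴)dirSq φ`,
`Σ_{perWin}‖curl W Nn‖ ≤ (c₃ + 8·card(Plane)·√(card n·c_V·N^d))(M^d∕M²)dirL1 φ`, `dirL1 Nn ≤ (c₄ + 2√(d·card n·c_V·N^d))(M^d∕M)dirL1 φ`. [folklore] -/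
theorem exists_landauNormalPart_lift
    (hPs : 8 * d * (((L : ℝ) ^ (j + 1)) * (((d : ℝ) - 1) * (((L : ℝ) ^ (j + 1)) - 1) * x)) ^ 2
      + 2 * (Fintype.card n * (4 * (d : ℝ) ^ 2 * ((L : ℝ) ^ (j + 1) - 1) ^ 2 * x + 16 * d * loopRad d L ((prop1Radius d L)^[j] x)) ^ 2)
        ≤ 1 / 2)
    {Z : Site d → Fin d → Matrix n n ℂ} (hZs : IsSkewDir Z) (hZP : IsPeriodicDir Z ((N * L ^ (j + 1) : ℕ) : ℤ)) :
    ∃ Nn : Site d → Fin d → Matrix n n ℂ,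
      IsSkewDir Nn ∧ IsPeriodicDir Nn ((N * L ^ (j + 1) : ℕ) : ℤ) ∧ IsLandauB8 (d := d) L N (j + 1) W Nn ∧
      QbarIter L (j + 1) W Nn = QbarIter L (j + 1) W Z ∧
      dirSq Nn (periodBox (d := d) (N * L ^ (j + 1)))
        ≤ (2 * (liftC d / (1 - thetaLoc d L * (((L : ℝ) ^ (j + 1)) ^ 2 * x))) ^ 2
            + 8 * Fintype.card n * ((d : ℝ) * liftC d ^ 2 * (2 * (d : ℝ) + 8) ^ 2 / (1 - thetaLoc d L * (((L : ℝ) ^ (j + 1)) ^ 2 * x)) ^ 2))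
          * (((L : ℝ) ^ (j + 1)) ^ d / ((L : ℝ) ^ (j + 1)) ^ 2) * dirSq (QbarIter L (j + 1) W Z) (periodBox (d := d) N) ∧
      curlSq W Nn (periodBox (d := d) (N * L ^ (j + 1)))
        ≤ (2 * (4 * d * (liftC d * (17 + 16 * (d : ℝ))) ^ 2 / (1 - thetaLoc d L * (((L : ℝ) ^ (j + 1)) ^ 2 * x)) ^ 2)
            + 128 * Fintype.card (T4AveragingDeficitWall.Plane d) * Fintype.card n
              * ((d : ℝ) * liftC d ^ 2 * (2 * (d : ℝ) + 8) ^ 2 / (1 - thetaLoc d L * (((L : ℝ) ^ (j + 1)) ^ 2 * x)) ^ 2))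
          * (((L : ℝ) ^ (j + 1)) ^ d / ((L : ℝ) ^ (j + 1)) ^ 4) * dirSq (QbarIter L (j + 1) W Z) (periodBox (d := d) N) ∧
      ∑ p ∈ perWin d (N * L ^ (j + 1)), ‖curl W Nn p‖
        ≤ (2 * d * (liftC d * (17 + 16 * (d : ℝ))) / (1 - thetaLoc d L * (((L : ℝ) ^ (j + 1)) ^ 2 * x))
            + 8 * Fintype.card (T4AveragingDeficitWall.Plane d)
              * Real.sqrt (Fintype.card n * ((d : ℝ) * liftC d ^ 2 * (2 * (d : ℝ) + 8) ^ 2 / (1 - thetaLoc d L * (((L : ℝ) ^ (j + 1)) ^ 2 * x)) ^ 2) * (N : ℝ) ^ d))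
          * (((L : ℝ) ^ (j + 1)) ^ d / ((L : ℝ) ^ (j + 1)) ^ 2) * dirL1 (QbarIter L (j + 1) W Z) (periodBox (d := d) N) ∧
      dirL1 Nn (periodBox (d := d) (N * L ^ (j + 1)))
        ≤ (liftC d / (1 - thetaLoc d L * (((L : ℝ) ^ (j + 1)) ^ 2 * x))
            + 2 * Real.sqrt ((d : ℝ) * Fintype.card n * ((d : ℝ) * liftC d ^ 2 * (2 * (d : ℝ) + 8) ^ 2 / (1 - thetaLoc d L * (((L : ℝ) ^ (j + 1)) ^ 2 * x)) ^ 2) * (N : ℝ) ^ d))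
          * (((L : ℝ) ^ (j + 1)) ^ d / (L : ℝ) ^ (j + 1)) * dirL1 (QbarIter L (j + 1) W Z) (periodBox (d := d) N) := by
  have hL1 : 1 ≤ L := by omega
  -- the coarse datum
  have hφs : IsSkewDir (QbarIter L (j + 1) W Z) := isSkewDir_QbarIter hL1 j hWu hx hs hWx hZs
  have hWPt : IsPeriodicCfg W ((tower L N (j + 1) : ℕ) : ℤ) := by rw [tower_eq_pow_mul, Nat.mul_comm]; exact hWP
  have hZPt : IsPeriodicDir Z ((tower L N (j + 1) : ℕ) : ℤ) := by rw [tower_eq_pow_mul, Nat.mul_comm]; exact hZP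
  have hφP : IsPeriodicDir (QbarIter L (j + 1) W Z) (N : ℤ) := isPeriodicDir_QbarIter L N (j + 1) hWPt hZPt
  -- the lift of the solved datum and its letters
  set Y : Site d → Fin d → Matrix n n ℂ :=
    covLift (L ^ (j + 1)) W (extDir N ((solveW hL j hWu hx hs hWx N hθ (resSkew N hφs) : ↥(skewSub d n N)) : TDir d n N)) with hYdef
  have hYQ : QbarIter L (j + 1) W Y = QbarIter L (j + 1) W Z := QbarIter_covLift_solveW hL j hWu hWPt hx hs hWx hθ hφs hφP
  have hYs : IsSkewDir Y := covLift_solveW_skew (N := N) hL j hWu hx hs hWx hθ hφs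
  have hYP : IsPeriodicDir Y ((N * L ^ (j + 1) : ℕ) : ℤ) := covLift_solveW_periodic hL j hWu hWPt hx hs hWx hθ hφs
  have hY1 := covLift_solveW_R1 (N := N) hL j hWu hx hs hWx hθ hθl hφs hd
  have hY2 := covLift_solveW_R2 (N := N) hL j hWu hx hs hWx hθ hθl hε hφs
  have hY3 := covLift_solveW_R3 (N := N) hL j hWu hx hs hWx hθ hθl hε hφs
  have hY4 := covLift_solveW_R4 (N := N) hL j hWu hx hs hWx hθ hθl hφs hd
  have hV := covDiv_lift_le hL hN hd j hWu hx hs hWx hθ hθl hε hφs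
  have hcV : 0 ≤ (d : ℝ) * liftC d ^ 2 * (2 * (d : ℝ) + 8) ^ 2 / (1 - thetaLoc d L * (((L : ℝ) ^ (j + 1)) ^ 2 * x)) ^ 2 := by
    have := liftC_nonneg d; positivity
  -- the Landau correction
  obtain ⟨lam, hlam, hLan⟩ := exists_landauB8_correction hL1 hN j hWu hWP hx hs hWx Y
  obtain ⟨hNs, hNP, hNL, hNQ⟩ := landauNormalPart_structure hL j hWu hWP hx hs hWx hYs hYP hYQ hlam hLan
  refine ⟨fun y μ => Y y μ + gaugeDir W lam y μ, hNs, hNP, hNL, hNQ, ?_, ?_, ?_, ?_⟩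
  · exact landauNormalPart_R1 hL hN j hWu hWP hx hs hWx hPs hYP hlam hLan le_rfl hV hY1
  · exact landauNormalPart_R2 hL hN j hWu hWP hx hs hWx hε hPs hYP hlam hLan le_rfl hcV hV hY2
  · exact landauNormalPart_R3 hL hN j hWu hWP hx hs hWx hε hPs hYP hlam hLan le_rfl hcV hV hY3
  · exact landauNormalPart_R4 hL hN j hWu hWP hx hs hWx hPs hYP hlam hLan le_rfl hcV hV hY4

end Lift

end

end Summit.QuantumFields.BalabanUV.T4Continuum.NE3.NormalPartB8Lift
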